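import Summits.CriticalPhenomena.PercolationContinuityZ3.Theorems.Transplant.LinearGrowthCriticalProbOne
import Literature.Barriers.CriticalPhenomena.SubexponentialGrowthZd
import Literature.Probability.Percolation.Percolation
import HarnessLib
import Literature.Probability.Percolation.SuperlinearGrowthCriticalProb

/-!
# The hypothesis of Benjamini–Schramm's Conjecture 4 is a GROWTH condition: `p_c < 1 ⟺` superlinear growth, for quasi-transitive graphs — modulo the
# named published fact of Duminil-Copin–Goswami–Raoufi–Severo–Yadin 2020 (Thm. 1.3), the forward direction being kernel (gen 24)

builds on p205010 (kernel theorem, internal audit signed; external expert review pending) — nothing in this file uses p205010; no node.  CONDITIONAL on the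
named published fact `DGRSY2020_superlinear_criticalProb_lt_one` (a Literature `def … : Prop` stated verbatim below; NOT proved in the tree); the
direction `p_c < 1 ⟹ superlinear` is the unconditional kernel theorem `LinGrowth.superlinear_of_criticalProb_lt_one_of_isQuasiTransitive` (p383715).
Lane `prim-bschramm`, seat `prim-bschramm-p4` gen 24 (PART C3 of `P4-GENERAL.md` §46).  Helper file (`--supports stmt-CriticalPhenomena-4575 --as helper`).

THE POINT ("be exact about what remains").  Conjecture 4 reads "assuming `p_c < 1`".  For a connected locally finite quasi-transitive graph this
proviso is EXACTLY superlinear volume growth (`limsup |B(x,r)|/r = ∞`): **`GrowthHyp.criticalProb_lt_one_iff_superlinear`**.  So the class map's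
hypothesis column is a statement about growth alone, and Conjecture 4 is equivalent (modulo DGRSY) to: *every connected locally finite quasi-transitive
graph of superlinear growth has `θ_v(p_c) = 0`* (`conj4_iff_growth_form`).
[cite: DuminilCopinGoswamiRaoufiSeveroYadin2020, Thm. 1.3 (p. 4)] [cite: BenjaminiSchramm1996, Conj. 4 ("assuming p_c < 1"); §2]
-/

noncomputable section

namespace Summit.CriticalPhenomena.PercolationContinuityZ3.Theorems.Transplant

open SimpleGraph Filter Literature.Barriers.CriticalPhenomena Literature.Probability.LatticeModels Literature.Probability.Percolation
open scoped Classical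

namespace GrowthHyp

variable {V : Type} (G : SimpleGraph V) [G.LocallyFinite]

/-- **THE HYPOTHESIS OF CONJ. 4 IS SUPERLINEAR GROWTH** (quasi-transitive graphs; ⟸ = DGRSY 2020 Thm 1.3 as a named fact, ⟹ = gen 24's kernel theorem
`LinGrowth.superlinear_of_criticalProb_lt_one_of_isQuasiTransitive`, which even gives the `liminf` form). CONDITIONAL on the named fact.
[cite: DuminilCopinGoswamiRaoufiSeveroYadin2020, Thm. 1.3 (p. 4)] [cite: BenjaminiSchramm1996, Conj. 4 ("assuming p_c < 1")] -/
theorem criticalProb_lt_one_iff_superlinear (hD : Literature.Probability.Percolation.DGRSY2020_superlinear_criticalProb_lt_one) (hc : G.Connected) (hq : IsQuasiTransitive G) (x : V) :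
    criticalProb G x < 1 ↔ ∀ C : ℕ, ∃ r : ℕ, C * (r + 1) < ballVolume G x r :=
  ⟨fun h C => (LinGrowth.superlinear_of_criticalProb_lt_one_of_isQuasiTransitive G x hq hc h C).exists, hD G hc hq x⟩

/-- The `liminf` (eventual) form is equivalent too: `p_c(G, x) < 1 ⟺ ∀ C, eventually C(n+1) < |B(x, n)|`. CONDITIONAL on the named fact.
[cite: DuminilCopinGoswamiRaoufiSeveroYadin2020, Thm. 1.3 (p. 4)] -/
theorem criticalProb_lt_one_iff_eventually (hD : Literature.Probability.Percolation.DGRSY2020_superlinear_criticalProb_lt_one) (hc : G.Connected) (hq : IsQuasiTransitive G) (x : V) :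
    criticalProb G x < 1 ↔ ∀ C : ℕ, ∀ᶠ n : ℕ in atTop, C * (n + 1) < ballVolume G x n :=
  ⟨fun h C => LinGrowth.superlinear_of_criticalProb_lt_one_of_isQuasiTransitive G x hq hc h C, fun h => hD G hc hq x fun C => (h C).exists⟩

/-- On a quasi-transitive graph `limsup |B(x,r)|/r = ∞` forces `liminf |B(x,r)|/r = ∞` (through `p_c < 1`). CONDITIONAL on the named fact.
[cite: DuminilCopinGoswamiRaoufiSeveroYadin2020, Thm. 1.3 (p. 4)] -/
theorem eventually_of_frequently_superlinear (hD : Literature.Probability.Percolation.DGRSY2020_superlinear_criticalProb_lt_one) (hc : G.Connected) (hq : IsQuasiTransitive G) (x : V)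
    (h : ∀ C : ℕ, ∃ r : ℕ, C * (r + 1) < ballVolume G x r) (C : ℕ) : ∀ᶠ n : ℕ in atTop, C * (n + 1) < ballVolume G x n :=
  LinGrowth.superlinear_of_criticalProb_lt_one_of_isQuasiTransitive G x hq hc (hD G hc hq x h) C

/-- **CONJECTURE 4 IN GROWTH FORM** (modulo the named fact): for connected locally finite quasi-transitive graphs, "`p_c < 1 ⟹ θ_v(p_c) = 0` at every
vertex" is equivalent to "superlinear growth ⟹ `θ_v(p_c) = 0` at every vertex". [cite: BenjaminiSchramm1996, Conj. 4] [cite: DuminilCopinGoswamiRaoufiSeveroYadin2020, Thm. 1.3] -/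
theorem conj4_iff_growth_form (hD : Literature.Probability.Percolation.DGRSY2020_superlinear_criticalProb_lt_one) (hc : G.Connected) (hq : IsQuasiTransitive G) (x : V) :
    ((∃ y : V, criticalProb G y < 1) → ∀ v : V, theta G v (criticalProbIOf G v) = 0) ↔
      ((∀ C : ℕ, ∃ r : ℕ, C * (r + 1) < ballVolume G x r) → ∀ v : V, theta G v (criticalProbIOf G v) = 0) := by
  constructor
  · intro h hgrowth
    exact h ⟨x, (criticalProb_lt_one_iff_superlinear G hD hc hq x).2 hgrowth⟩
  · rintro h ⟨y, hy⟩
    obtain ⟨D, hD'⟩ := hq.exists_degree_le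
    exact h fun C => (LinGrowth.superlinear_of_criticalProb_lt_one G x hc hD' hy C).exists

end GrowthHyp

end Summit.CriticalPhenomena.PercolationContinuityZ3.Theorems.Transplant

end
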